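import Summits.BirchSwinnertonDyer.Rank1Residual.F1Sign2.RegularKolyvaginPrimesAtTwo
import HarnessLib

/-!
# Cell `bsd-f1-sign2`, ES-18 support: R18-ALG `RegularInvolutionAlgebraAtTwo` and R18-LOC `RegularPrimeLocalCriterionAtTwo` ARE THEOREMS — `regularInvolutionAlgebraAtTwo_holds`, `regularPrimeLocalCriterionAtTwo_holds`

PROOF FILE (seat `-ty` g10, «discharge when cheap»; statement file `F1Sign2/RegularKolyvaginPrimesAtTwo.lean` p639849 = -es g9 Sketch18 v2,
REF1 §112: «R18-ALG/LOC are finite algebra — good first prover targets; e2/e3 are seeds»).  THEOREMS ONLY (no `def`, no `sorry`, standard axioms).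
The linear algebra over `R = ℤ/2^k` (`k ≥ 1`) behind «no index loss at a REGULAR Kolyvagin prime»: for `γ = (a b; c d)` with `a + d = 0`,
`ad − bc = −1` and `γ ≢ 1 (mod 2)`:
* `γ² = 1` (Cayley–Hamilton by hand: `(γ²)₀₀ = a² + bc = 1`, `(γ²)₀₁ = b(a + d) = 0`, …);
* `γ ≢ 1 (mod 2)` forces `b` or `c` to be a UNIT of `R`: if both are even then `1 = a² + bc` forces `a` odd (else `1 ∈ 2R`, but `2 ∉ Rˣ`),
  and then `γ − 1 = 2δ` with `δ = (α β; γ′ −α−1)` for `a = 2α + 1`, `b = 2β`, `c = 2γ′` — the excluded scalar-mod-2 case (parity in `ℤ/2^k`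
  via `ZMod.val`; odd elements are units because `2` is nilpotent);
* if `b ∈ Rˣ` (only `tr γ = 0` is used here): every `v` with `γv = −v` is `(γ − 1)(0, b⁻¹v₀)` (so `H¹(⟨γ⟩, R²) = 0`) and `v = (v₁ + (a+1)b⁻¹v₀)·e₂ + (γ − 1)(0, b⁻¹v₀)`
  (coinvariants cyclic, generator `e₂`); symmetrically with `c ∈ Rˣ`, `w = (c⁻¹v₁, 0)` and `e₁`.
For `γ = diag(1, −1)` (Gross's class at `Δ_E > 0`, scalar mod 2) both conclusions fail (REF1 §112 e1) — not treated here.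
PARTITION: none moved (support row of the U₀⁺ packet; U₀⁺ `HeegnerCornerPosDiscAtTwo` itself stays a theorem-candidate); beyond-print theorem: no
(textbook algebra).  BSD is not proved by any of this.
-/

set_option autoImplicit false

namespace Summit.BirchSwinnertonDyer.Rank1Residual.F1Sign2.RegularKolyvagin

open Matrix

section ZModTwoPow

variable {k : ℕ}

/-- `2` is nilpotent in `ℤ/2^k`. -/
theorem isNilpotent_two : IsNilpotent (2 : ZMod (2 ^ k)) :=
  ⟨k, by exact_mod_cast ZMod.natCast_self (2 ^ k)⟩

/-- Odd elements `2y + 1` of `ℤ/2^k` are units. -/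
theorem isUnit_two_mul_add_one (y : ZMod (2 ^ k)) : IsUnit (2 * y + 1) := by
  obtain ⟨n, hn⟩ := (isNilpotent_two (k := k))
  refine IsNilpotent.isUnit_add_one ⟨n, ?_⟩
  rw [mul_pow, hn, zero_mul]

/-- `2` is not a unit in `ℤ/2^k` for `k ≥ 1`. -/
theorem not_isUnit_two (hk : 1 ≤ k) : ¬ IsUnit (2 : ZMod (2 ^ k)) := by
  have h : ¬ IsUnit ((2 : ℕ) : ZMod (2 ^ k)) := by
    rw [ZMod.isUnit_iff_coprime, Nat.coprime_pow_right_iff (by omega), Nat.coprime_self]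
    norm_num
  simpa using h

/-- Every element of `ℤ/2^k` is `2y` or `2y + 1`. -/
theorem exists_eq_two_mul_or (x : ZMod (2 ^ k)) :
    (∃ y : ZMod (2 ^ k), x = 2 * y) ∨ ∃ y : ZMod (2 ^ k), x = 2 * y + 1 := by
  haveI : NeZero (2 ^ k) := ⟨pow_ne_zero _ two_ne_zero⟩
  rcases Nat.even_or_odd x.val with ⟨m, hm⟩ | ⟨m, hm⟩
  · refine Or.inl ⟨(m : ZMod (2 ^ k)), ?_⟩
    calc x = (x.val : ZMod (2 ^ k)) := (ZMod.natCast_zmod_val x).symm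
      _ = ((m + m : ℕ) : ZMod (2 ^ k)) := by rw [hm]
      _ = 2 * (m : ZMod (2 ^ k)) := by push_cast; ring
  · refine Or.inr ⟨(m : ZMod (2 ^ k)), ?_⟩
    calc x = (x.val : ZMod (2 ^ k)) := (ZMod.natCast_zmod_val x).symm
      _ = ((2 * m + 1 : ℕ) : ZMod (2 ^ k)) := by rw [hm]
      _ = 2 * (m : ZMod (2 ^ k)) + 1 := by push_cast; ring

/-- A non-unit of `ℤ/2^k` is even. -/
theorem exists_eq_two_mul_of_not_isUnit (x : ZMod (2 ^ k)) (hx : ¬ IsUnit x) : ∃ y : ZMod (2 ^ k), x = 2 * y := by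
  rcases exists_eq_two_mul_or x with h | ⟨y, rfl⟩
  · exact h
  · exact absurd (isUnit_two_mul_add_one y) hx

end ZModTwoPow

section Matrix

variable {R : Type*} [CommRing R]

/-- `γ² = 1` from `tr γ = 0`, `det γ = −1` (any commutative ring). -/
theorem mul_self_eq_one_of_trace_zero_det_neg_one (γ : Matrix (Fin 2) (Fin 2) R) (htr : γ.trace = 0) (hdet : γ.det = -1) :
    γ * γ = 1 := by
  rw [Matrix.trace_fin_two] at htr
  rw [Matrix.det_fin_two] at hdet
  have hd : γ 1 1 = -γ 0 0 := by linear_combination htr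
  ext i j
  fin_cases i <;> fin_cases j
  · simp [Matrix.mul_apply, Fin.sum_univ_two]
    linear_combination (γ 0 0) * htr - hdet
  · simp [Matrix.mul_apply, Fin.sum_univ_two]
    linear_combination (γ 0 1) * htr
  · simp [Matrix.mul_apply, Fin.sum_univ_two]
    linear_combination (γ 1 0) * htr
  · simp [Matrix.mul_apply, Fin.sum_univ_two]
    linear_combination (γ 1 1) * htr - hdet

/-- The `b`-unit case: `H¹ = 0` and cyclic coinvariants with generator `e₂`. -/
theorem h1_and_coinv_of_isUnit_b (γ : Matrix (Fin 2) (Fin 2) R) (htr : γ.trace = 0) (hb : IsUnit (γ 0 1)) :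
    (∀ v : Fin 2 → R, γ.mulVec v + v = 0 → ∃ w : Fin 2 → R, v = γ.mulVec w - w) ∧
    (∃ u : Fin 2 → R, ∀ v : Fin 2 → R, ∃ (a : R) (w : Fin 2 → R), v = a • u + (γ.mulVec w - w)) := by
  rw [Matrix.trace_fin_two] at htr
  obtain ⟨bi, hbi⟩ := hb.exists_left_inv   -- bi * b = 1
  have hd : γ 1 1 = -γ 0 0 := by linear_combination htr
  refine ⟨fun v hv => ?_, ⟨![0, 1], fun v => ?_⟩⟩
  · -- v = (γ - 1) (0, bi * v 0)
    have h0 := congr_fun hv 0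
    have h1 := congr_fun hv 1
    simp at h0 h1
    refine ⟨![0, bi * v 0], ?_⟩
    ext i
    fin_cases i
    · simp
      linear_combination (-(v 0)) * hbi
    · simp [hd]
      linear_combination bi * h0 - (v 1) * hbi
  · refine ⟨v 1 + (γ 0 0 + 1) * bi * v 0, ![0, bi * v 0], ?_⟩
    ext i
    fin_cases i
    · simp
      linear_combination (-(v 0)) * hbi
    · simp [hd]
      ring

/-- The `c`-unit case: `H¹ = 0` and cyclic coinvariants with generator `e₁`. -/
theorem h1_and_coinv_of_isUnit_c (γ : Matrix (Fin 2) (Fin 2) R) (htr : γ.trace = 0) (hc : IsUnit (γ 1 0)) :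
    (∀ v : Fin 2 → R, γ.mulVec v + v = 0 → ∃ w : Fin 2 → R, v = γ.mulVec w - w) ∧
    (∃ u : Fin 2 → R, ∀ v : Fin 2 → R, ∃ (a : R) (w : Fin 2 → R), v = a • u + (γ.mulVec w - w)) := by
  rw [Matrix.trace_fin_two] at htr
  obtain ⟨ci, hci⟩ := hc.exists_left_inv   -- ci * c = 1
  have hd : γ 1 1 = -γ 0 0 := by linear_combination htr
  refine ⟨fun v hv => ?_, ⟨![1, 0], fun v => ?_⟩⟩
  · have h0 := congr_fun hv 0
    have h1 := congr_fun hv 1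
    simp at h0 h1
    refine ⟨![ci * v 1, 0], ?_⟩
    ext i
    fin_cases i
    · simp
      rw [hd] at h1
      linear_combination ci * h1 - (v 0) * hci
    · simp [hd]
      linear_combination (-(v 1)) * hci
  · refine ⟨v 0 - (γ 0 0 - 1) * ci * v 1, ![ci * v 1, 0], ?_⟩
    ext i
    fin_cases i
    · simp
      ring
    · simp [hd]
      linear_combination (-(v 1)) * hci

end Matrix

/-- If `b` and `c` are both even and `a² + bc = 1` in `ℤ/2^k` (`k ≥ 1`), then `γ − 1 ∈ 2·M₂` — the scalar-mod-2 case. -/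
theorem exists_sub_one_eq_two_smul {k : ℕ} (hk : 1 ≤ k) (γ : Matrix (Fin 2) (Fin 2) (ZMod (2 ^ k)))
    (htr : γ.trace = 0) (hdet : γ.det = -1) (hb : ¬ IsUnit (γ 0 1)) (hc : ¬ IsUnit (γ 1 0)) :
    ∃ δ : Matrix (Fin 2) (Fin 2) (ZMod (2 ^ k)), γ - 1 = 2 • δ := by
  rw [Matrix.trace_fin_two] at htr
  rw [Matrix.det_fin_two] at hdet
  have hd : γ 1 1 = -γ 0 0 := by linear_combination htr
  obtain ⟨β, hβ⟩ := exists_eq_two_mul_of_not_isUnit _ hb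
  obtain ⟨γ', hγ'⟩ := exists_eq_two_mul_of_not_isUnit _ hc
  rcases exists_eq_two_mul_or (γ 0 0) with ⟨α, hα⟩ | ⟨α, hα⟩
  · -- a even: 1 = a² + bc ∈ 2R, contradiction with 2 ∉ Rˣ
    exfalso
    apply not_isUnit_two hk
    have h1 : (2 : ZMod (2 ^ k)) * (2 * α * α + 2 * β * γ') = 1 := by
      rw [hd, hβ, hγ', hα] at hdet
      linear_combination -hdet
    exact IsUnit.of_mul_eq_one _ h1
  · refine ⟨!![α, β; γ', -α - 1], ?_⟩
    ext i j
    fin_cases i <;> fin_cases j <;> simp [Matrix.sub_apply, Matrix.smul_apply, hα, hβ, hγ', hd]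
    all_goals ring

/-- **R18-ALG is a theorem.** -/
theorem regularInvolutionAlgebraAtTwo_holds : RegularInvolutionAlgebraAtTwo := by
  intro k hk γ htr hdet hns
  refine ⟨mul_self_eq_one_of_trace_zero_det_neg_one γ htr hdet, ?_⟩
  by_cases hb : IsUnit (γ 0 1)
  · exact h1_and_coinv_of_isUnit_b γ htr hb
  by_cases hc : IsUnit (γ 1 0)
  · exact h1_and_coinv_of_isUnit_c γ htr hc
  exact absurd (exists_sub_one_eq_two_smul hk γ htr hdet hb hc) hns

example : RegularInvolutionAlgebraAtTwo := regularInvolutionAlgebraAtTwo_holds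

/-! ### R18-LOC `RegularPrimeLocalCriterionAtTwo` is a theorem (REF1 §112: «sign-free AND regularity-free»)

Write `t = tr F = 2b`, `ℓ + 1 = 2a`.  Cayley–Hamilton gives `F² − 1 = tF − (ℓ + 1) = 2Ψ` with `Ψ := bF − a`, and `F·φ = ℓ·Ψ` for Gross's operator
`φ := aF − b` (`φ(x) = ((ℓ+1)/2)·Fx − (t/2)·x`).  So the hypothesis `n·φ(x) = (F² − 1)y` (`n` odd) gives, after applying `F`,
`Ψ(nℓ·x − 2Fy) = 0`; and `det Ψ = a² − b² > 0` by Hasse (`t² < 4ℓ ≤ (ℓ+1)²`), so `Ψ` is injective on `ℤ²` and `nℓ·x = 2·Fy`, i.e.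
`x` is `2`-divisible up to the odd multiplier `nℓ` (with `y′ = 0`).  The non-scalarity hypothesis is not used (REF1 §112 r1, e3).
The polynomial identities below were found with explicit cofactors (adjugate of `Ψ`) and are checked by `linear_combination`. -/

/-- **R18-LOC is a theorem** (Gross 1991 Prop. 6.2 (2) made sign-free at `p = 2`; regularity-free). -/
theorem regularPrimeLocalCriterionAtTwo_holds : RegularPrimeLocalCriterionAtTwo := by
  intro F ℓ hdet htr hℓ1 hhasse _hns x hx
  obtain ⟨n, y, hn, H⟩ := hx
  obtain ⟨b, hb⟩ := htr
  obtain ⟨a, ha⟩ := hℓ1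
  have hb2 : F.trace / 2 = b := by rw [hb]; simp
  have ha2 : ((ℓ : ℤ) + 1) / 2 = a := by rw [ha]; simp
  rw [ha2, hb2] at H
  have hℓ : (ℓ : ℤ) = 2 * a - 1 := by linear_combination ha
  rw [Matrix.trace_fin_two] at hb
  have hs : F 1 1 = 2 * b - F 0 0 := by linear_combination hb
  rw [Matrix.det_fin_two, hs, hℓ] at hdet
  rw [Matrix.trace_fin_two, hs, hℓ] at hhasse
  have H0 := congr_fun H 0
  have H1 := congr_fun H 1
  simp only [Pi.smul_apply, Pi.sub_apply, smul_eq_mul] at H0 H1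
  simp [Matrix.mulVec, dotProduct, Fin.sum_univ_two, Matrix.mul_apply, Matrix.one_apply, hs] at H0 H1
  -- Ψ(nℓ·x − 2Fy) = 0, componentwise
  have E0 : (b * F 0 0 - a) * (n * (2 * a - 1) * x 0 - 2 * (F 0 0 * y 0 + F 0 1 * y 1))
      + b * F 0 1 * (n * (2 * a - 1) * x 1 - 2 * (F 1 0 * y 0 + (2 * b - F 0 0) * y 1)) = 0 := by
    linear_combination (F 0 0) * H0 + (F 0 1) * H1
      + ((-1) * F 0 1 * y 1 + (-1) * F 0 0 * y 0 + n * a * x 0) * hdet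
  have E1 : b * F 1 0 * (n * (2 * a - 1) * x 0 - 2 * (F 0 0 * y 0 + F 0 1 * y 1))
      + (b * (2 * b - F 0 0) - a) * (n * (2 * a - 1) * x 1 - 2 * (F 1 0 * y 0 + (2 * b - F 0 0) * y 1)) = 0 := by
    linear_combination (F 1 0) * H0 + (2 * b - F 0 0) * H1
      + ((-1) * F 1 0 * y 0 + F 0 0 * y 1 + (-2) * b * y 1 + n * a * x 1) * hdet
  -- det Ψ = a² − b² ≠ 0 (Hasse), adjugate
  have hD : a ^ 2 - b ^ 2 ≠ 0 := by nlinarith [hhasse, sq_nonneg (a - 1)]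
  have G0 : (a ^ 2 - b ^ 2) * (n * (2 * a - 1) * x 0 - 2 * (F 0 0 * y 0 + F 0 1 * y 1)) = 0 := by
    linear_combination (b * (2 * b - F 0 0) - a) * E0 - b * F 0 1 * E1
      + (2 * b ^ 2 * F 0 1 * y 1 + 2 * b ^ 2 * F 0 0 * y 0 + n * b ^ 2 * x 0 + (-2) * n * a * b ^ 2 * x 0) * hdet
  have G1 : (a ^ 2 - b ^ 2) * (n * (2 * a - 1) * x 1 - 2 * (F 1 0 * y 0 + (2 * b - F 0 0) * y 1)) = 0 := by
    linear_combination (b * F 0 0 - a) * E1 - b * F 1 0 * E0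
      + (2 * b ^ 2 * F 1 0 * y 0 + (-2) * b ^ 2 * F 0 0 * y 1 + 4 * b ^ 3 * y 1 + n * b ^ 2 * x 1
          + (-2) * n * a * b ^ 2 * x 1) * hdet
  have hw0 := (mul_eq_zero.mp G0).resolve_left hD
  have hw1 := (mul_eq_zero.mp G1).resolve_left hD
  refine ⟨n * (2 * a - 1), F.mulVec y, 0, hn.mul ⟨a - 1, by ring⟩, ?_⟩
  ext i
  fin_cases i
  · simp
    linear_combination hw0
  · simp [hs]
    linear_combination hw1

example : RegularPrimeLocalCriterionAtTwo := regularPrimeLocalCriterionAtTwo_holds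

end Summit.BirchSwinnertonDyer.Rank1Residual.F1Sign2.RegularKolyvagin
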